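import Literature.Geometry.Kaehler.ComplexTorusHodgeGroupEqFirstCohomologyHodgeGroup
import Literature.Geometry.Kaehler.ComplexTorusMumfordTateGroupComplexPoints
import Literature.AlgebraicGeometry.Motives.HodgeGroupKernelMultiplierCharacterSign
import HarnessLib

/-!
# `MT(X)(ℂ)` IS `MT(H¹(X, ℚ))(ℂ)` in lattice coordinates, and the sharp form of the Hodge-group dictionary
# (`γ ∈ Hg(H¹)(ℂ) ⟺ hOneMatrix γ ∈ Hg(X)(ℂ)` — the isometry clause is automatic for a polarised `X`)

[topic Geometry/Kaehler]

Layer `Literature/Geometry/Kaehler`, namespace `Literature.Geometry.Kaehler.ComplexTorus`; lane `lit-hodgefound`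
(Track 2 foundations library), Layer A4, skeleton seat `lit-hodgefound-skel-4` (generation 40): the MUMFORD–TATE sibling of
A4-101 (rider; theorems only — no definition, no instance, no named fact; D-0026 net debt `0`).

## The point of this file

A4-100 ∕ A4-101 identify the Hodge groups of the two carriers: `γ ∈ Hg(H¹(X, ℚ))(ℂ) ⟺ γ ∈ Aut(Q_ℂ) ∧ hOneMatrix γ ∈ Hg(X)(ℂ)`
(`mem_hodgeGroupBaseChange_iff_exists_mem_hodgeGroupC`).  For a POLARISED `X` the isometry clause is redundant —
`Hg(X)(ℂ) ≤ S(X)(ℂ)` (`hodgeGroupC_le_lefschetzGroupC`) makes `γ_g ∈ S_Q(H¹)(ℂ) ⊆ Aut(Q_ℂ)` (A4-101 §5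
`IsRiemannForm.autOfSL_mem_hodgeGroupBaseChange`) — whence the SHARP DICTIONARY (§1)

  **`γ ∈ Hg(H¹(X, ℚ))(ℂ) ⟺ ∃ g ∈ Hg(X)(ℂ), g = hOneMatrix γ`**,

and, both carriers having «`MT = 𝔾_m · Hg`» on complex points (torus: `mem_mumfordTateGroupC_iff_exists_eq_scalar_mul`,
Lange Remark 7.2.2 (2) ∕ Gordon Lemma 2.3 (iii); weight-one Hodge structure: p34's
`HodgeStructure.mem_mumfordTateGroupBaseChange_iff_exists_smulOfUnit_mul_mem_of_isAlgClosed`, GGK §I.B), the MUMFORD–TATE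
DICTIONARY (§2)

  **`γ ∈ MT(H¹(X, ℚ))(ℂ) ⟺ ∃ g ∈ MT(X)(ℂ), g = hOneMatrix γ`**, **`MT(X)(ℂ) = {hOneMatrix γ : γ ∈ MT(H¹(X, ℚ))(ℂ)}`**.

## Sources, verbatim (held texts)

* H. Lange, *Abelian Varieties over the Complex Numbers* (2023) [Lange2023AbelianVarietiesComplex], §7.2.1 Remark 7.2.2 (2)
  (`MT(X) = 𝔾_m · Hg(X)`, «the smallest algebraic subgroup of `GL(V)` defined over `ℚ` containing `h(ℂ*)`»), §7.2.2 p. 331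
  («Consider `H¹(X, ℚ) = V^*` as the dual representation»).
* B. B. Gordon, *A survey of the Hodge conjecture for abelian varieties* [Gordon1999HodgeAVSurvey], §2.3 Lemma (iii)
  («`MT(V) = 𝔾_m · Hg(V)`»).
* M. Green, P. Griffiths, M. Kerr, *Mumford–Tate Groups and Domains* (2012) [GreenGriffithsKerr2012], §I.B (p. 35: «`M_φ̃` is
  the almost direct product of `M_φ` and the homotheties»; (I.B.1)).
* J. Carlson, S. Müller-Stach, C. Peters, *Period Mappings and Period Domains* (2017) [CarlsonMullerStachPeters2017], §15.2
  Remark (ii) after Def. 15.2.1 («`MT(h) = SMT(h) · h∘w(𝔾_m)`»).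

## What is proved (`X = E/Φ(ℤ^ι)` polarised by `η`, rational Gram matrix `G`; §2 for `dim X > 0`)

* §1 `hOneMatrix_smul`, `hOneMatrix_smulOfUnit_mul`, **`IsRiemannForm.mem_hodgeGroupBaseChange_iff_exists_coe_eq_hOneMatrix`**
  (the sharp Hodge dictionary, no isometry clause).
* §2 **`IsRiemannForm.mem_mumfordTateGroupBaseChange_iff_exists_coe_eq_hOneMatrix`** (`γ ∈ MT(H¹)(ℂ) ⟺ hOneMatrix γ ∈ MT(X)(ℂ)`),
  **`IsRiemannForm.image_coe_mumfordTateGroupC_eq_image_hOneMatrix_mumfordTateGroupBaseChange`** (`MT(X)(ℂ) = MT(H¹(X, ℚ))(ℂ)` as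
  sets of matrices).

NOT here: a `MulEquiv` packaging for `MT` (as A4-101 §5 does for `Hg`); real points.

## References

* [Lange2023AbelianVarietiesComplex] H. Lange, *Abelian Varieties over the Complex Numbers* (2023): §7.2.1 Remark 7.2.2 (2), §7.2.2 p. 331.
* [Gordon1999HodgeAVSurvey] B. B. Gordon, *A survey of the Hodge conjecture for abelian varieties* (1999): §2.3 Lemma (iii).
* [GreenGriffithsKerr2012] M. Green, P. Griffiths, M. Kerr, *Mumford–Tate Groups and Domains* (2012): §I.B p. 35 and (I.B.1).
* [CarlsonMullerStachPeters2017] J. Carlson, S. Müller-Stach, C. Peters, *Period Mappings and Period Domains*, 2nd ed. (2017): §15.2.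

## Provenance

Lane `lit-hodgefound`, seat skel-4 (generation 40); consumes BY NAME A4-99 (`hOneMatrix`, `hOneMatrix_injective`,
`hOneMatrix_toLinearEquiv'`), A4-101 (`exists_mem_hodgeGroupC_coe_eq_hOneMatrix_of_mem_hodgeGroupBaseChange`, `autOfSL`,
`hOneMatrix_autOfSL`, `autOfSL_eq_of_hOneMatrix_eq`, `IsRiemannForm.autOfSL_mem_hodgeGroupBaseChange`),
`ComplexTorusMumfordTateGroupComplexPoints` (`mem_mumfordTateGroupC_iff_exists_eq_scalar_mul`), `ComplexTorusMumfordTateGroupIrreducible` (`coe_scalar_mul_toGL`),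
`Motives/HodgeGroupKernelMultiplierCharacterSign` (`HodgeStructure.mem_mumfordTateGroupBaseChange_iff_exists_smulOfUnit_mul_mem_of_isAlgClosed`),
`ComplexTorusFirstCohomologyPolarization` (`IsRiemannForm.isPolarizable_hodgeStructure_one'`), `ComplexTorusRationalFormsBasis`
(`finrank_rationalForms_eq_choose`, `card_eq_two_mul_finrank`), Mathlib `LinearEquiv.smulOfUnit`, `Matrix.GeneralLinearGroup.scalar`.
-/

noncomputable section

-- Nested instance problems on the carrier `↥(rationalForms Φ 1)` (cf. `ComplexTorusSigmaPiFirstCohomology`).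
set_option maxSynthPendingDepth 3

open scoped TensorProduct Matrix
open Module Function Matrix

namespace Literature.Geometry.Kaehler

namespace ComplexTorus

open Literature.AlgebraicGeometry.Motives (HodgeStructure HodgeTensorFacts)

/-! ## §1 Scalars in the dictionary; the sharp Hodge-group dictionary for a polarised `X` -/

section Scalars

variable {ι : Type*} [Fintype ι] [DecidableEq ι] {E : Type*} [NormedAddCommGroup E] [NormedSpace ℂ E]
  (Φ : (ι → ℝ) ≃L[ℝ] E)

/-- `hOneMatrix (c · γ) = c · hOneMatrix γ`. [cite: Lange2023AbelianVarietiesComplex, §1.1.2 p. 20 (matrices of linear maps)] -/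
theorem hOneMatrix_smul (c : ℂ) (γ : (ℂ ⊗[ℚ] rationalForms Φ 1) →ₗ[ℂ] (ℂ ⊗[ℚ] rationalForms Φ 1)) :
    hOneMatrix Φ (c • γ) = c • hOneMatrix Φ γ := by
  rw [hOneMatrix, map_smul, transpose_smul, hOneMatrix]

omit [Fintype ι] [DecidableEq ι] in
/-- The homothety `c · id` composed with `γ`, as a linear map: `(c · id) ∘ γ = c · γ`. [folklore] -/
private theorem toLinearMap_smulOfUnit_mul (c : ℂˣ) (γ : (ℂ ⊗[ℚ] rationalForms Φ 1) ≃ₗ[ℂ] (ℂ ⊗[ℚ] rationalForms Φ 1)) :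
    (LinearEquiv.smulOfUnit c * γ).toLinearMap = (c : ℂ) • γ.toLinearMap :=
  LinearMap.ext fun _ ↦ rfl

/-- `hOneMatrix ((c · id) ∘ γ) = c · hOneMatrix γ`. [cite: Lange2023AbelianVarietiesComplex, §7.2.1 Remark 7.2.2 (2)] -/
theorem hOneMatrix_smulOfUnit_mul (c : ℂˣ) (γ : (ℂ ⊗[ℚ] rationalForms Φ 1) ≃ₗ[ℂ] (ℂ ⊗[ℚ] rationalForms Φ 1)) :
    hOneMatrix Φ (LinearEquiv.smulOfUnit c * γ).toLinearMap = (c : ℂ) • hOneMatrix Φ γ.toLinearMap := by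
  rw [toLinearMap_smulOfUnit_mul, hOneMatrix_smul]

end Scalars

section Dictionary

-- universe-`0` carriers for the abstract groups (`[HodgeTensorFacts.{0,0}]`, discharged by `hodgeTensorFacts_holds`) and
-- `H¹(X, ℚ)` finite-dimensional as an instance argument (discharge: `instModuleFiniteRationalForms Φ 1`), as in A4-98 ∕ A4-101.
variable {ι : Type} [Fintype ι] [DecidableEq ι] {E : Type} [NormedAddCommGroup E] [NormedSpace ℂ E]
  {Φ : (ι → ℝ) ≃L[ℝ] E} [HodgeTensorFacts.{0, 0}] [Module.Finite ℚ (rationalForms Φ 1)]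
  {η : E [⋀^Fin 2]→L[ℝ] ℝ} {G : Matrix ι ι ℚ}

/-- **THE SHARP HODGE DICTIONARY: `γ ∈ Hg(H¹(X, ℚ))(ℂ) ⟺ ∃ g ∈ Hg(X)(ℂ), g = hOneMatrix γ`** for a polarised `X` — the
isometry clause of A4-101's `mem_hodgeGroupBaseChange_iff_exists_mem_hodgeGroupC` is automatic: `Hg(X)(ℂ) ≤ S(X)(ℂ)` puts
`γ = γ_g` into `S_Q(H¹)(ℂ) ⊆ Aut(Q_ℂ)` (A4-101 §5). [cite: GreenGriffithsKerr2012, §I.B (I.B.1)] [cite: Lange2023AbelianVarietiesComplex, §7.2.2 (p. 331) and §7.2.4 Exercise (4)] -/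
theorem IsRiemannForm.mem_hodgeGroupBaseChange_iff_exists_coe_eq_hOneMatrix (hη : IsRiemannForm Φ η)
    (hG : G.map (Rat.cast : ℚ → ℝ) = latticeGram Φ η) (Q : (hodgeStructure Φ 1).Polarization)
    (γ : (ℂ ⊗[ℚ] rationalForms Φ 1) ≃ₗ[ℂ] (ℂ ⊗[ℚ] rationalForms Φ 1)) :
    γ ∈ (hodgeStructure Φ 1).hodgeGroupBaseChange ℂ ↔ ∃ g ∈ hodgeGroupC Φ, (g : Matrix ι ι ℂ) = hOneMatrix Φ γ.toLinearMap := by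
  refine ⟨exists_mem_hodgeGroupC_coe_eq_hOneMatrix_of_mem_hodgeGroupBaseChange Φ Q, ?_⟩
  rintro ⟨g, hg, hgγ⟩
  rw [← autOfSL_eq_of_hOneMatrix_eq Φ hgγ.symm]
  exact hη.autOfSL_mem_hodgeGroupBaseChange hG Q hg

/-! ## §2 The Mumford–Tate dictionary -/

omit [DecidableEq ι] [HodgeTensorFacts.{0, 0}] [Module.Finite ℚ (rationalForms Φ 1)] in
/-- `dim X > 0 ⟹ H¹(X, ℚ) ≠ 0` (`dim_ℚ H¹ = |ι| = 2 dim_ℂ X`). [cite: Lange2023AbelianVarietiesComplex, §1.1.3 Exercise 1.1.6 (8)] -/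
private theorem nontrivial_rationalForms_one_of_finrank_pos [FiniteDimensional ℂ E] (hE : 0 < finrank ℂ E) :
    Nontrivial (rationalForms Φ 1) :=
  Module.nontrivial_of_finrank_pos (R := ℚ) (by
    rw [finrank_rationalForms_eq_choose Φ 1, Nat.choose_one_right, card_eq_two_mul_finrank Φ]; omega)

variable [FiniteDimensional ℂ E]

/-- **THE MUMFORD–TATE DICTIONARY: `γ ∈ MT(H¹(X, ℚ))(ℂ) ⟺ ∃ g ∈ MT(X)(ℂ), g = hOneMatrix γ`** (polarised `X` of positive
dimension): both carriers satisfy `MT(ℂ) = ℂˣ · Hg(ℂ)` («`MT = 𝔾_m · Hg`» on complex points), `hOneMatrix (c·γ) = c · hOneMatrix γ`,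
and §1 handles `Hg`. [cite: Lange2023AbelianVarietiesComplex, §7.2.1 Remark 7.2.2 (2)] [cite: Gordon1999HodgeAVSurvey, §2.3 Lemma (iii)]
[cite: GreenGriffithsKerr2012, §I.B p. 35 and (I.B.1)] [cite: CarlsonMullerStachPeters2017, §15.2 Remark (ii) after Def. 15.2.1] -/
theorem IsRiemannForm.mem_mumfordTateGroupBaseChange_iff_exists_coe_eq_hOneMatrix (hη : IsRiemannForm Φ η)
    (hG : G.map (Rat.cast : ℚ → ℝ) = latticeGram Φ η) (hE : 0 < finrank ℂ E)
    (γ : (ℂ ⊗[ℚ] rationalForms Φ 1) ≃ₗ[ℂ] (ℂ ⊗[ℚ] rationalForms Φ 1)) :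
    γ ∈ (hodgeStructure Φ 1).mumfordTateGroupBaseChange ℂ ↔
      ∃ g ∈ mumfordTateGroupC Φ, (g : Matrix ι ι ℂ) = hOneMatrix Φ γ.toLinearMap := by
  haveI := nontrivial_rationalForms_one_of_finrank_pos (Φ := Φ) hE
  have hpol := hη.isPolarizable_hodgeStructure_one' Φ hE
  obtain ⟨Q⟩ := hpol
  rw [HodgeStructure.mem_mumfordTateGroupBaseChange_iff_exists_smulOfUnit_mul_mem_of_isAlgClosed ℂ
    (by norm_num) ⟨Q⟩ γ]
  constructor
  · rintro ⟨c, hc⟩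
    obtain ⟨N, hN, hNγ⟩ := exists_mem_hodgeGroupC_coe_eq_hOneMatrix_of_mem_hodgeGroupBaseChange Φ Q hc
    rw [hOneMatrix_smulOfUnit_mul] at hNγ
    refine ⟨Matrix.GeneralLinearGroup.scalar ι c⁻¹ * Matrix.SpecialLinearGroup.toGL N,
      (mem_mumfordTateGroupC_iff_exists_eq_scalar_mul Φ).2 ⟨c⁻¹, N, hN, rfl⟩, ?_⟩
    rw [coe_scalar_mul_toGL, hNγ, smul_smul, Units.val_inv_eq_inv_val, inv_mul_cancel₀ c.ne_zero, one_smul]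
  · rintro ⟨g, hg, hgγ⟩
    obtain ⟨α, N, hN, rfl⟩ := (mem_mumfordTateGroupC_iff_exists_eq_scalar_mul Φ).1 hg
    rw [coe_scalar_mul_toGL] at hgγ
    refine ⟨α⁻¹, ?_⟩
    have hmat : hOneMatrix Φ (LinearEquiv.smulOfUnit α⁻¹ * γ).toLinearMap = N.1 := by
      rw [hOneMatrix_smulOfUnit_mul, ← hgγ, smul_smul, Units.val_inv_eq_inv_val, inv_mul_cancel₀ α.ne_zero, one_smul]
    rw [← autOfSL_eq_of_hOneMatrix_eq Φ hmat]
    exact hη.autOfSL_mem_hodgeGroupBaseChange hG Q hN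

/-- **`MT(X)(ℂ)` IS `MT(H¹(X, ℚ))(ℂ)`**: for a polarised abelian variety of positive dimension, Lange's Mumford–Tate group
`MT(X) ≤ GL(H₁(X, ℚ))` (the smallest `ℚ`-subgroup of `GL(V)` whose real points contain `h(ℂ*)`) and the Mumford–Tate group of the
weight-one Hodge structure `H¹(X, ℚ)` (the group fixing the Hodge tensors up to the Tate character) have the same complex points as
sets of matrices under `γ ↦ hOneMatrix γ`. [cite: Lange2023AbelianVarietiesComplex, §7.2.1 Remark 7.2.2 (2) and §7.2.2 (p. 331)]
[cite: Gordon1999HodgeAVSurvey, §2.3 Lemma (iii)] [cite: GreenGriffithsKerr2012, §I.B (I.B.1)] -/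
theorem IsRiemannForm.image_coe_mumfordTateGroupC_eq_image_hOneMatrix_mumfordTateGroupBaseChange (hη : IsRiemannForm Φ η)
    (hG : G.map (Rat.cast : ℚ → ℝ) = latticeGram Φ η) (hE : 0 < finrank ℂ E) :
    (fun g : GL ι ℂ ↦ (g : Matrix ι ι ℂ)) '' (mumfordTateGroupC Φ : Set (GL ι ℂ)) =
      (fun γ : (ℂ ⊗[ℚ] rationalForms Φ 1) ≃ₗ[ℂ] (ℂ ⊗[ℚ] rationalForms Φ 1) ↦ hOneMatrix Φ γ.toLinearMap) ''
        ((hodgeStructure Φ 1).mumfordTateGroupBaseChange ℂ : Set _) := by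
  ext M
  simp only [Set.mem_image, SetLike.mem_coe]
  constructor
  · rintro ⟨g, hg, rfl⟩
    -- `γ_g`, the automorphism with `hOneMatrix γ_g = g`
    have hdet : IsUnit (g : Matrix ι ι ℂ)ᵀ.det := by
      rw [det_transpose]
      exact (Matrix.isUnits_det_units g)
    refine ⟨Matrix.toLinearEquiv (coordOneFormBasisC Φ) (g : Matrix ι ι ℂ)ᵀ hdet, ?_, hOneMatrix_toLinearEquiv' Φ hdet⟩
    exact (hη.mem_mumfordTateGroupBaseChange_iff_exists_coe_eq_hOneMatrix hG hE _).2 ⟨g, hg, (hOneMatrix_toLinearEquiv' Φ hdet).symm⟩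
  · rintro ⟨γ, hγ, rfl⟩
    obtain ⟨g, hg, hgγ⟩ := (hη.mem_mumfordTateGroupBaseChange_iff_exists_coe_eq_hOneMatrix hG hE γ).1 hγ
    exact ⟨g, hg, hgγ⟩

end Dictionary

end ComplexTorus

end Literature.Geometry.Kaehler

end
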